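import Summits.CriticalPhenomena.PercolationContinuityZ3.Theorems.PercNearOneGluingNoHeavyQuantPropFan
import Summits.CriticalPhenomena.PercolationContinuityZ3.Theorems.PercNearOneGluingNoHeavyQuantSymTripleTwoChain
import Summits.CriticalPhenomena.PercolationContinuityZ3.Theorems.PercNearOneGluingNoHeavyQuantGluedForestSDEC
import Summits.CriticalPhenomena.PercolationContinuityZ3.Theorems.PercNearOneGluingNoHeavyQuantSGCNoLowRightHolds
import HarnessLib

/-!
# QUANT lane R8, T-DEC: THE SYMMETRIC FOREST OF `k` TWO-CHAINS IN THE LIGHT BAND `k·q·(1+p) ≤ 3` IS SDEC AT EVERY TOP-AFFORDABLE FLOOR —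
# EVERY WIDTH `k ≥ 3`, NO ORACLE — by the route `1 → 3` and two Handelman certificates in POISSON COORDINATES `(1/k, kq(1−p), kqp)` (census-1 g28)

builds on p205010 (kernel theorem, internal audit signed; external expert review pending)

Support file (`--supports stmt-CriticalPhenomena-4575`), QUANT lane seat prim-quant-census-1 (gen 28); memo
`run/shared/lean/prim/quant/prim-quant-census-1/g28/FAN-G28.md` §4, §7.  Theorems only, standard axioms, no sorries, default heartbeats.  Over this seat's
`…QuantPropFan` (`decAt_gate_flaw_of_oneLowFan`), arm-1 g54's `…QuantSymTripleTwoChain` / `…QuantTorqueRoutes`, `…QuantGluedForestSDEC`, `…QuantSGCNoLowRightHolds`.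

THE THEOREM.  `L` = `k ≥ 3` copies of the 2-chain `t = gate_q(δ₁ ∗ gate_p δ₁)` (`0 < q, p < 1`), `0 < x`, `2x ≤ q(1+p)` (every top-affordable floor; tree-OK
floors qualify), **`k·q·(1+p) ≤ 3`** ⟹ **`SDEC x (ftop L) (flaw L)`** (`sdec_symForest_twoChain_light`, tree-OK form `…_treeOK`).  `k` IS A VARIABLE: census-1
g26's `(k−1)q ≤ 1` and arm-1 g53's `sdec_symForest_trueFloor` (`q ≤ 1/2`, every width) hold GIVEN THE ORACLE, arm-1 g54's `sdec_tc3` is `k = 3`; unconditional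
k-general SDEC was known only in the half-top / `fmean ≤ 2` / low-ceiling bands (arm-1 g49/g54).  New content: `2 < kq(1+p) ≤ 3` at floors `x > q(1+p)/4`.

THE PROOF.  Gate `a`, `T = a·kq(1+p)`: `T ≤ 2` — no positive low atom (`decAt_all_of_noPosLow`); `2 < T ≤ 3` — the positive low atom `1` goes to the atom `3`
(cost-safe: `2y ≤ T/3 ≤ T−1`), `decAt_gate_flaw_of_oneLowFan` with `H = {3}`.  Capacity (`symTC_capacity`): with the k-SYMBOLIC atoms `Q·f₁ = k u Q^k`,
`Q³·f₃ = k u Q^k·B`, `u = q(1−p)`, `v = qp`, `Q = 1−q`, `B = (k−1)vQ + (k−1)(k−2)u²/6` (`flaw_replicate_tc_atoms`, from the recurrence `flaw_cons_tc`) it is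
`γ·Q² ≤ (1−γ)·B`, `γ = max(y, (T−2)/2)`: branch `γ = (T−2)/2 ≤ (s−2)/2`: `(s−2)Q² ≤ (4−s)B` (`symTC_bracketD`); branch `γ = y ≤ q(1+p)/2`:
`(q(1+p)/2)Q² ≤ (1−q(1+p)/2)B` (`symTC_bracketE`).  In the coordinates `e = 1/k`, `l1 = k u`, `l2 = k v` (`s = l1 + 2 l2`, `Q = 1 − e(l1+l2)`,
`(k−1)vQ = (1−e) l2 Q`, `(k−1)(k−2)u²/6 = (1−e)(1−2e) l1²/6`) both are polynomials strictly positive on the POLYTOPE `{0 ≤ e ≤ 1/3, l ≥ 0, 2 ≤ s ≤ 3}`, hence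
Handelman-certifiable: `symTC_certD` (degree 5, 41 products of `e, 1−3e, l1, l2, s−2, 3−s`, positive rationals; LP + exact repair + symbolic check, kit j277449),
`symTC_certE` (degree 6, 57 products, kit j277567) — each ONE `ring` identity plus a sum of nonnegative products.  The D-margin's infimum is the Poisson limit
(`e → 0`, `l1 = 3/2`, `s = 3`: 1/8).  "`1/k` as a polytope coordinate" is the reusable device for k-symbolic symmetric families.  Evidence (kit j276490): for
2-chain forests of every width the route `1 → 3` certifies every sampled row with `2 < T ≤ 3`; the non-identical statement is the conjecture of memo §4a.

HONEST STATUS.  One explicit family, one band; `SiblingStep` ⟺ `GateStepN`, `UPartStep`, `LightResidDECOracle`, `FarTreeRow` OPEN; RATE class (log\*) / honest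
sentence of `run/shared/lean/prim/quant/README.md` unchanged.  [this work].  Handelman's Positivstellensatz is used only to FIND the certificates (checked by
`ring`); nothing here is cited as a published result.  The gluing rows served [cite: KozmaNitzan2024, Conjecture 3 (p. 15)]; product measure [cite: Grimmett1999, §1.3 p. 10].
-/

noncomputable section

open scoped BigOperators

namespace Summit.CriticalPhenomena.PercolationContinuityZ3.Theorems
namespace Quant
namespace LawDec

open Finset

/-- the point mass `δ_K` -/
local notation3 "δ[" K "]" => (fun k : ℕ => if k = (K : ℕ) then (1 : ℝ) else 0)

/-- the 2-chain sub-forest law `ρ_p = δ₁ ∗ gate_p δ₁` -/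
local notation3 "ρ₂[" p "]" => lconv 1 1 (fun k : ℕ => if k = (1 : ℕ) then (1 : ℝ) else 0)
  (gate (fun k : ℕ => if k = (1 : ℕ) then (1 : ℝ) else 0) p)

/-- the 2-chain sibling `t = gate_q(δ₁ ∗ gate_p δ₁)` with recorded sub-floor `x₁` and gate count `1` -/
local notation3 "TC[" q ", " p ", " x₁ "]" => (⟨q, x₁, 1, 2, ρ₂[p]⟩ : Sib)

/-- the symmetric forest of `k` identical 2-chains -/
local notation3 "Lk[" k ", " q ", " p ", " x₁ "]" => (List.replicate k TC[q, p, x₁] : List Sib)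

/-! ### The atoms `f₀ … f₃` of `k` identical 2-chains -/

/-- one more 2-chain in front of a sibling list: `f′(h) = (1−q)·f(h) + q(1−p)·f(h−1) + qp·f(h−2)`. [this work] -/
theorem flaw_cons_tc (q p x₁ : ℝ) (L : List Sib) (h : ℕ) :
    flaw (TC[q, p, x₁] :: L) h = (1 - q) * flaw L h + q * (1 - p) * (if 1 ≤ h then flaw L (h - 1) else 0)
      + q * p * (if 2 ≤ h then flaw L (h - 2) else 0) := by
  show lconv (ftop L) 2 (flaw L) (gate (ρ₂[p]) q) h = _
  rw [lconv_eq_sum_shift (ftop L) 2 (flaw L) (gate (ρ₂[p]) q) (flaw_eq_zero_of_lt L) h]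
  simp only [Finset.sum_range_succ, Finset.sum_range_zero, zero_add, gate_tc_apply]
  have h0 : (if (0 : ℕ) ≤ h then flaw L (h - 0) else 0) = flaw L h := by rw [if_pos (Nat.zero_le h), Nat.sub_zero]
  rw [h0]
  norm_num

/-- **the first four atoms of `k` identical 2-chains** (`u = q(1−p)`, `v = qp`, `Q = 1−q`), in a subtraction-free form valid for every `k`:
`f₀ = Q^k`, `Q·f₁ = k·u·Q^k`, `Q²·f₂ = k·v·Q^{k+1} + (k(k−1)/2)·u²·Q^k`, `Q³·f₃ = k(k−1)·u·v·Q^{k+1} + (k(k−1)(k−2)/6)·u³·Q^k`. [this work] -/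
theorem flaw_replicate_tc_atoms (q p x₁ : ℝ) : ∀ k : ℕ,
    flaw Lk[k, q, p, x₁] 0 = (1 - q) ^ k ∧
    (1 - q) * flaw Lk[k, q, p, x₁] 1 = (k : ℝ) * (q * (1 - p)) * (1 - q) ^ k ∧
    (1 - q) ^ 2 * flaw Lk[k, q, p, x₁] 2
      = (k : ℝ) * (q * p) * (1 - q) ^ (k + 1) + ((k : ℝ) * ((k : ℝ) - 1) / 2) * (q * (1 - p)) ^ 2 * (1 - q) ^ k ∧
    (1 - q) ^ 3 * flaw Lk[k, q, p, x₁] 3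
      = (k : ℝ) * ((k : ℝ) - 1) * (q * (1 - p)) * (q * p) * (1 - q) ^ (k + 1)
        + ((k : ℝ) * ((k : ℝ) - 1) * ((k : ℝ) - 2) / 6) * (q * (1 - p)) ^ 3 * (1 - q) ^ k
  | 0 => by
    simp only [List.replicate_zero, flaw, Nat.cast_zero]
    norm_num
  | k + 1 => by
    obtain ⟨h0, h1, h2, h3⟩ := flaw_replicate_tc_atoms q p x₁ k
    rw [List.replicate_succ]
    refine ⟨?_, ?_, ?_, ?_⟩
    · rw [flaw_cons_tc, h0]; norm_num; ring
    · rw [flaw_cons_tc]; norm_num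
      have e1 : (1 - q) * ((1 - q) * flaw Lk[k, q, p, x₁] 1 + q * (1 - p) * flaw Lk[k, q, p, x₁] 0)
          = (1 - q) * ((1 - q) * flaw Lk[k, q, p, x₁] 1) + q * (1 - p) * (1 - q) * flaw Lk[k, q, p, x₁] 0 := by ring
      rw [e1, h1, h0]; ring
    · rw [flaw_cons_tc]; norm_num
      have e2 : (1 - q) ^ 2 * ((1 - q) * flaw Lk[k, q, p, x₁] 2 + q * (1 - p) * flaw Lk[k, q, p, x₁] 1 + q * p * flaw Lk[k, q, p, x₁] 0)
          = (1 - q) * ((1 - q) ^ 2 * flaw Lk[k, q, p, x₁] 2) + q * (1 - p) * (1 - q) * ((1 - q) * flaw Lk[k, q, p, x₁] 1)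
            + q * p * (1 - q) ^ 2 * flaw Lk[k, q, p, x₁] 0 := by ring
      rw [e2, h2, h1, h0]; ring
    · rw [flaw_cons_tc]; norm_num
      have e3 : (1 - q) ^ 3 * ((1 - q) * flaw Lk[k, q, p, x₁] 3 + q * (1 - p) * flaw Lk[k, q, p, x₁] 2 + q * p * flaw Lk[k, q, p, x₁] 1)
          = (1 - q) * ((1 - q) ^ 3 * flaw Lk[k, q, p, x₁] 3) + q * (1 - p) * (1 - q) * ((1 - q) ^ 2 * flaw Lk[k, q, p, x₁] 2)
            + q * p * (1 - q) ^ 2 * ((1 - q) * flaw Lk[k, q, p, x₁] 1) := by ring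
      rw [e3, h3, h2, h1]; ring

/-! ### The two capacity certificates (Poisson coordinates `e = 1/k`, `l1 = k·q(1−p)`, `l2 = k·qp`) -/

/-- **Handelman certificate (degree 5, 41 products; kit j277449) for the route-`1→3` capacity of `k` identical 2-chains in POISSON COORDINATES** `e = 1/k`, `l1 = kq(1−p)`, `l2 = kqp`, `s = l1 + 2·l2 = fmean`: on the polytope `0 ≤ e ≤ 1/3`, `l ≥ 0`, `2 ≤ s ≤ 3`, `(4 − s)(1 − e)[l2(1 − e(l1+l2)) + (1 − 2e)l1²/6] − (s − 2)(1 − e(l1+l2))² ≥ 0` (it is `(4−s)·[(k−1)vQ + (k−1)(k−2)u²/6] − (s−2)Q²` with `u = q(1−p)`, `v = qp`, `Q = 1−q`). [this work] -/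
theorem symTC_certD (e l1 l2 : ℝ) (he : 0 ≤ e) (h3e : 0 ≤ 1 - 3 * e) (hl1 : 0 ≤ l1) (hl2 : 0 ≤ l2)
    (hs2 : 0 ≤ l1 + 2 * l2 - 2) (hs3 : 0 ≤ 3 - (l1 + 2 * l2)) :
    0 ≤ (4 - (l1 + 2 * l2)) * (1 - e) * (l2 * (1 - e * (l1 + l2)) + (1 - 2 * e) * l1 ^ 2 / 6) - ((l1 + 2 * l2) - 2) * (1 - e * (l1 + l2)) ^ 2 := by
  have key : (4 - (l1 + 2 * l2)) * (1 - e) * (l2 * (1 - e * (l1 + l2)) + (1 - 2 * e) * l1 ^ 2 / 6) - ((l1 + 2 * l2) - 2) * (1 - e * (l1 + l2)) ^ 2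
      = (5 / 288 : ℝ)
        + (73 / 1728 : ℝ) * ((3 - (l1 + 2 * l2))) + (5 / 36 : ℝ) * ((1 - 3 * e) * (3 - (l1 + 2 * l2)))
        + (1 / 48 : ℝ) * (l2 ^ 2) + (71 / 288 : ℝ) * (l2 * (3 - (l1 + 2 * l2)))
        + (97 / 648 : ℝ) * ((1 - 3 * e) * l1 * (3 - (l1 + 2 * l2))) + (71 / 108 : ℝ) * ((1 - 3 * e) * l2 * (3 - (l1 + 2 * l2)))
        + (161 / 15552 : ℝ) * (l1 ^ 3) + (107 / 1944 : ℝ) * (l2 ^ 3)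
        + (185 / 2592 : ℝ) * (l2 * (3 - (l1 + 2 * l2)) ^ 2) + (115 / 7776 : ℝ) * ((3 - (l1 + 2 * l2)) ^ 3)
        + (2 / 27 : ℝ) * (e * (1 - 3 * e) * l1 ^ 2) + (16 / 81 : ℝ) * ((1 - 3 * e) ^ 2 * l1 * (3 - (l1 + 2 * l2)))
        + (17 / 648 : ℝ) * ((1 - 3 * e) * l1 ^ 2 * (3 - (l1 + 2 * l2))) + (1 / 54 : ℝ) * ((1 - 3 * e) * l2 ^ 2 * (3 - (l1 + 2 * l2)))
        + (5 / 216 : ℝ) * ((1 - 3 * e) * (l1 + 2 * l2 - 2) * (3 - (l1 + 2 * l2)) ^ 2) + (7 / 15552 : ℝ) * (l1 ^ 4)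
        + (73 / 5184 : ℝ) * (l1 ^ 3 * (3 - (l1 + 2 * l2))) + (671 / 5832 : ℝ) * (l2 ^ 3 * (3 - (l1 + 2 * l2)))
        + (223 / 1296 : ℝ) * (l2 ^ 2 * (3 - (l1 + 2 * l2)) ^ 2) + (29 / 288 : ℝ) * (l2 * (3 - (l1 + 2 * l2)) ^ 3)
        + (839 / 46656 : ℝ) * ((3 - (l1 + 2 * l2)) ^ 4) + (1 / 27 : ℝ) * (e * (1 - 3 * e) * l1 * l2 * (l1 + 2 * l2 - 2))
        + (4 / 9 : ℝ) * (e * (1 - 3 * e) * l1 * (l1 + 2 * l2 - 2) ^ 2) + (5 / 81 : ℝ) * (e * l1 ^ 2 * l2 ^ 2)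
        + (1 / 27 : ℝ) * (e * l1 ^ 2 * l2 * (l1 + 2 * l2 - 2)) + (2 / 81 : ℝ) * ((1 - 3 * e) ^ 2 * l1 * l2 * (3 - (l1 + 2 * l2)))
        + (2 / 9 : ℝ) * ((1 - 3 * e) ^ 2 * l2 ^ 2 * (3 - (l1 + 2 * l2))) + (1 / 486 : ℝ) * ((1 - 3 * e) * l1 ^ 4)
        + (7 / 972 : ℝ) * ((1 - 3 * e) * l1 ^ 3 * (3 - (l1 + 2 * l2))) + (1 / 486 : ℝ) * ((1 - 3 * e) * l1 ^ 2 * (3 - (l1 + 2 * l2)) ^ 2)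
        + (1 / 324 : ℝ) * ((1 - 3 * e) * l1 * (l1 + 2 * l2 - 2) * (3 - (l1 + 2 * l2)) ^ 2) + (4 / 81 : ℝ) * ((1 - 3 * e) * l2 ^ 4)
        + (2 / 81 : ℝ) * ((1 - 3 * e) * l2 ^ 3 * (3 - (l1 + 2 * l2))) + (29 / 23328 : ℝ) * (l1 ^ 4 * l2)
        + (29 / 7776 : ℝ) * (l1 ^ 3 * l2 * (3 - (l1 + 2 * l2))) + (29 / 46656 : ℝ) * (l1 ^ 3 * (l1 + 2 * l2 - 2) * (3 - (l1 + 2 * l2)))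
        + (29 / 2916 : ℝ) * (l1 * l2 ^ 4) + (29 / 46656 : ℝ) * (l1 * (3 - (l1 + 2 * l2)) ^ 4)
        + (29 / 2916 : ℝ) * (l2 ^ 3 * (3 - (l1 + 2 * l2)) ^ 2) + (29 / 5832 : ℝ) * (l2 ^ 2 * (3 - (l1 + 2 * l2)) ^ 3) := by ring
  rw [key]
  exact (add_nonneg (add_nonneg (add_nonneg (add_nonneg (add_nonneg (add_nonneg (add_nonneg (add_nonneg (add_nonneg (add_nonneg (add_nonneg (add_nonneg (add_nonneg (add_nonneg (add_nonneg (add_nonneg (add_nonneg (add_nonneg (add_nonneg (add_nonneg (add_nonneg (add_nonneg (add_nonneg (add_nonneg (add_nonneg (add_nonneg (add_nonneg (add_nonneg (add_nonneg (add_nonneg (add_nonneg (add_nonneg (add_nonneg (add_nonneg (add_nonneg (add_nonneg (add_nonneg (add_nonneg (add_nonneg (add_nonneg (by norm_num) (mul_nonneg (by norm_num) hs3)) (mul_nonneg (by norm_num) (mul_nonneg h3e hs3))) (mul_nonneg (by norm_num) (pow_nonneg hl2 2))) (mul_nonneg (by norm_num) (mul_nonneg hl2 hs3))) (mul_nonneg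 (by norm_num) (mul_nonneg (mul_nonneg h3e hl1) hs3))) (mul_nonneg (by norm_num) (mul_nonneg (mul_nonneg h3e hl2) hs3))) (mul_nonneg (by norm_num) (pow_nonneg hl1 3))) (mul_nonneg (by norm_num) (pow_nonneg hl2 3))) (mul_nonneg (by norm_num) (mul_nonneg hl2 (pow_nonneg hs3 2)))) (mul_nonneg (by norm_num) (pow_nonneg hs3 3))) (mul_nonneg (by norm_num) (mul_nonneg (mul_nonneg he h3e) (pow_nonneg hl1 2)))) (mul_nonneg (by norm_num) (mul_nonneg (mul_nonneg (pow_nonneg h3e 2) hl1) hs3))) (mul_nonneg (by norm_num) (mul_nonneg (mul_nonneg h3e (pow_nonneg hl1 2)) hs3))) (mul_nonneg (by norm_num) (mul_nonneg (mul_nonneg h3e (pow_nonneg hl2 2)) hs3))) (mul_nonneg (by norm_num) (mul_nonneg (mul_nonneg h3e hs2) (pow_nonneg hs3 2)))) (mul_nonneg (by norm_num) (pow_nonneg hl1 4))) (mul_nonneg (by norm_num) (mul_nonneg (pow_nonneg hl1 3) hs3))) (mul_nonneg (by norm_num) (mul_nonneg (pow_nonneg hl2 3) hs3))) (mul_nonneg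 (by norm_num) (mul_nonneg (pow_nonneg hl2 2) (pow_nonneg hs3 2)))) (mul_nonneg (by norm_num) (mul_nonneg hl2 (pow_nonneg hs3 3)))) (mul_nonneg (by norm_num) (pow_nonneg hs3 4))) (mul_nonneg (by norm_num) (mul_nonneg (mul_nonneg (mul_nonneg (mul_nonneg he h3e) hl1) hl2) hs2))) (mul_nonneg (by norm_num) (mul_nonneg (mul_nonneg (mul_nonneg he h3e) hl1) (pow_nonneg hs2 2)))) (mul_nonneg (by norm_num) (mul_nonneg (mul_nonneg he (pow_nonneg hl1 2)) (pow_nonneg hl2 2)))) (mul_nonneg (by norm_num) (mul_nonneg (mul_nonneg (mul_nonneg he (pow_nonneg hl1 2)) hl2) hs2))) (mul_nonneg (by norm_num) (mul_nonneg (mul_nonneg (mul_nonneg (pow_nonneg h3e 2) hl1) hl2) hs3))) (mul_nonneg (by norm_num) (mul_nonneg (mul_nonneg (pow_nonneg h3e 2) (pow_nonneg hl2 2)) hs3))) (mul_nonneg (by norm_num) (mul_nonneg h3e (pow_nonneg hl1 4)))) (mul_nonneg (by norm_num) (mul_nonneg (mul_nonneg h3e (pow_nonneg hl1 3)) hs3)))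 (mul_nonneg (by norm_num) (mul_nonneg (mul_nonneg h3e (pow_nonneg hl1 2)) (pow_nonneg hs3 2)))) (mul_nonneg (by norm_num) (mul_nonneg (mul_nonneg (mul_nonneg h3e hl1) hs2) (pow_nonneg hs3 2)))) (mul_nonneg (by norm_num) (mul_nonneg h3e (pow_nonneg hl2 4)))) (mul_nonneg (by norm_num) (mul_nonneg (mul_nonneg h3e (pow_nonneg hl2 3)) hs3))) (mul_nonneg (by norm_num) (mul_nonneg (pow_nonneg hl1 4) hl2))) (mul_nonneg (by norm_num) (mul_nonneg (mul_nonneg (pow_nonneg hl1 3) hl2) hs3))) (mul_nonneg (by norm_num) (mul_nonneg (mul_nonneg (pow_nonneg hl1 3) hs2) hs3))) (mul_nonneg (by norm_num) (mul_nonneg hl1 (pow_nonneg hl2 4)))) (mul_nonneg (by norm_num) (mul_nonneg hl1 (pow_nonneg hs3 4)))) (mul_nonneg (by norm_num) (mul_nonneg (pow_nonneg hl2 3) (pow_nonneg hs3 2)))) (mul_nonneg (by norm_num) (mul_nonneg (pow_nonneg hl2 2) (pow_nonneg hs3 3))))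


/-- **Handelman certificate (degree 6, 57 products; kit j277567) for the FLOOR SUB-CASE of the route-`1→3` capacity of `k` identical 2-chains in Poisson coordinates**: with `w = s·e/2 = q(1+p)/2` (the largest top-affordable floor at gate `1`), `(1 − w)(1 − e)[l2(1 − e(l1+l2)) + (1 − 2e)l1²/6] − w(1 − e(l1+l2))² ≥ 0` on the same polytope (it is `(1−w)·[(k−1)vQ + (k−1)(k−2)u²/6] − w·Q²`). [this work] -/
theorem symTC_certE (e l1 l2 : ℝ) (h3e : 0 ≤ 1 - 3 * e) (hl1 : 0 ≤ l1) (hl2 : 0 ≤ l2)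
    (hs2 : 0 ≤ l1 + 2 * l2 - 2) (hs3 : 0 ≤ 3 - (l1 + 2 * l2)) :
    0 ≤ (1 - (l1 + 2 * l2) * e / 2) * (1 - e) * (l2 * (1 - e * (l1 + l2)) + (1 - 2 * e) * l1 ^ 2 / 6) - ((l1 + 2 * l2) * e / 2) * (1 - e * (l1 + l2)) ^ 2 := by
  have key : (1 - (l1 + 2 * l2) * e / 2) * (1 - e) * (l2 * (1 - e * (l1 + l2)) + (1 - 2 * e) * l1 ^ 2 / 6) - ((l1 + 2 * l2) * e / 2) * (1 - e * (l1 + l2)) ^ 2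
      = (43 / 788 : ℝ) * ((1 - 3 * e))
        + (1513 / 37833 : ℝ) * (l2) + (349 / 2364 : ℝ) * ((1 - 3 * e) * l2)
        + (361 / 226998 : ℝ) * (l1 * (l1 + 2 * l2 - 2)) + (14777 / 680994 : ℝ) * (l2 ^ 2)
        + (5 / 216 : ℝ) * ((1 - 3 * e) ^ 2 * l1) + (5 / 27 : ℝ) * ((1 - 3 * e) ^ 2 * l2)
        + (1 / 72 : ℝ) * ((1 - 3 * e) ^ 2 * (l1 + 2 * l2 - 2)) + (38 / 1773 : ℝ) * ((1 - 3 * e) * l2 ^ 2)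
        + (180031 / 32687712 : ℝ) * (l1 ^ 3) + (38222 / 1021491 : ℝ) * (l2 ^ 2 * (3 - (l1 + 2 * l2)))
        + (1 / 12 : ℝ) * ((1 - 3 * e) ^ 2 * l1 * l2) + (4 / 27 : ℝ) * ((1 - 3 * e) ^ 2 * l2 ^ 2)
        + (248 / 15957 : ℝ) * ((1 - 3 * e) * l1 ^ 3) + (143 / 1182 : ℝ) * ((1 - 3 * e) * l2 ^ 2 * (3 - (l1 + 2 * l2)))
        + (70 / 1773 : ℝ) * ((1 - 3 * e) * l2 * (3 - (l1 + 2 * l2)) ^ 2) + (55169 / 16343856 : ℝ) * (l1 ^ 3 * l2)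
        + (165593 / 98063136 : ℝ) * (l1 ^ 3 * (3 - (l1 + 2 * l2))) + (48607 / 5447952 : ℝ) * (l1 ^ 2 * (l1 + 2 * l2 - 2) * (3 - (l1 + 2 * l2)))
        + (159395 / 49031568 : ℝ) * (l1 * (l1 + 2 * l2 - 2) * (3 - (l1 + 2 * l2)) ^ 2) + (21829 / 6128946 : ℝ) * (l2 ^ 3 * (3 - (l1 + 2 * l2)))
        + (84211 / 36773676 : ℝ) * (l2 ^ 2 * (3 - (l1 + 2 * l2)) ^ 2) + (2 / 27 : ℝ) * ((1 - 3 * e) ^ 3 * l2 ^ 2)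
        + (19 / 432 : ℝ) * ((1 - 3 * e) ^ 2 * l1 ^ 2 * (3 - (l1 + 2 * l2))) + (17 / 216 : ℝ) * ((1 - 3 * e) ^ 2 * l1 * l2 * (3 - (l1 + 2 * l2)))
        + (5 / 216 : ℝ) * ((1 - 3 * e) ^ 2 * l2 * (l1 + 2 * l2 - 2) * (3 - (l1 + 2 * l2))) + (1 / 432 : ℝ) * ((1 - 3 * e) ^ 2 * (l1 + 2 * l2 - 2) ^ 2 * (3 - (l1 + 2 * l2)))
        + (277 / 63828 : ℝ) * ((1 - 3 * e) * l1 ^ 3 * l2) + (509 / 127656 : ℝ) * ((1 - 3 * e) * l1 ^ 3 * (l1 + 2 * l2 - 2))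
        + (7 / 42552 : ℝ) * ((1 - 3 * e) * l1 ^ 2 * (l1 + 2 * l2 - 2) ^ 2) + (401 / 127656 : ℝ) * ((1 - 3 * e) * l1 * (3 - (l1 + 2 * l2)) ^ 3)
        + (554 / 15957 : ℝ) * ((1 - 3 * e) * l2 ^ 4) + (322 / 15957 : ℝ) * ((1 - 3 * e) * l2 ^ 3 * (3 - (l1 + 2 * l2)))
        + (29 / 5319 : ℝ) * ((1 - 3 * e) * l2 ^ 2 * (3 - (l1 + 2 * l2)) ^ 2) + (43 / 42552 : ℝ) * ((1 - 3 * e) * (l1 + 2 * l2 - 2) * (3 - (l1 + 2 * l2)) ^ 3)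
        + (3631 / 24515784 : ℝ) * (l1 ^ 3 * l2 ^ 2) + (59369 / 73547352 : ℝ) * (l1 ^ 2 * (l1 + 2 * l2 - 2) * (3 - (l1 + 2 * l2)) ^ 2)
        + (36473 / 36773676 : ℝ) * (l1 * (l1 + 2 * l2 - 2) * (3 - (l1 + 2 * l2)) ^ 3) + (1100453 / 55160514 : ℝ) * (l2 ^ 3 * (3 - (l1 + 2 * l2)) ^ 2)
        + (380147 / 27580257 : ℝ) * (l2 ^ 2 * (3 - (l1 + 2 * l2)) ^ 3) + (2 / 81 : ℝ) * ((1 - 3 * e) ^ 3 * l1 ^ 3)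
        + (17 / 162 : ℝ) * ((1 - 3 * e) ^ 3 * l1 ^ 2 * l2) + (1 / 9 : ℝ) * ((1 - 3 * e) ^ 3 * l1 * l2 ^ 2)
        + (1 / 27 : ℝ) * ((1 - 3 * e) ^ 3 * l2 ^ 2 * (l1 + 2 * l2 - 2)) + (11 / 2364 : ℝ) * ((1 - 3 * e) * l1 * l2 * (l1 + 2 * l2 - 2) ^ 3)
        + (11 / 2364 : ℝ) * ((1 - 3 * e) * l1 * l2 * (3 - (l1 + 2 * l2)) ^ 3) + (5323 / 294189408 : ℝ) * (l1 ^ 6)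
        + (55169 / 294189408 : ℝ) * (l1 ^ 4 * (3 - (l1 + 2 * l2)) ^ 2) + (35569 / 110321028 : ℝ) * (l1 ^ 3 * l2 ^ 3)
        + (99445 / 220642056 : ℝ) * (l1 ^ 3 * l2 ^ 2 * (3 - (l1 + 2 * l2))) + (40469 / 27580257 : ℝ) * (l1 ^ 2 * l2 * (l1 + 2 * l2 - 2) * (3 - (l1 + 2 * l2)) ^ 2)
        + (230783 / 441284112 : ℝ) * (l1 ^ 2 * (l1 + 2 * l2 - 2) * (3 - (l1 + 2 * l2)) ^ 3) + (140045 / 441284112 : ℝ) * (l1 * (l1 + 2 * l2 - 2) * (3 - (l1 + 2 * l2)) ^ 4)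
        + (39200 / 27580257 : ℝ) * (l2 ^ 6) + (110338 / 27580257 : ℝ) * (l2 ^ 5 * (3 - (l1 + 2 * l2)))
        + (103907 / 36773676 : ℝ) * (l2 ^ 2 * (3 - (l1 + 2 * l2)) ^ 4) + (11098 / 9193419 : ℝ) * (l2 * (3 - (l1 + 2 * l2)) ^ 5) := by ring
  rw [key]
  exact (add_nonneg (add_nonneg (add_nonneg (add_nonneg (add_nonneg (add_nonneg (add_nonneg (add_nonneg (add_nonneg (add_nonneg (add_nonneg (add_nonneg (add_nonneg (add_nonneg (add_nonneg (add_nonneg (add_nonneg (add_nonneg (add_nonneg (add_nonneg (add_nonneg (add_nonneg (add_nonneg (add_nonneg (add_nonneg (add_nonneg (add_nonneg (add_nonneg (add_nonneg (add_nonneg (add_nonneg (add_nonneg (add_nonneg (add_nonneg (add_nonneg (add_nonneg (add_nonneg (add_nonneg (add_nonneg (add_nonneg (add_nonneg (add_nonneg (add_nonneg (add_nonneg (add_nonneg (add_nonneg (add_nonneg (add_nonneg (add_nonneg (add_nonneg (add_nonneg (add_nonneg (add_nonneg (add_nonneg (add_nonneg (add_nonneg (mul_nonneg (by norm_num) h3e)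 (mul_nonneg (by norm_num) hl2)) (mul_nonneg (by norm_num) (mul_nonneg h3e hl2))) (mul_nonneg (by norm_num) (mul_nonneg hl1 hs2))) (mul_nonneg (by norm_num) (pow_nonneg hl2 2))) (mul_nonneg (by norm_num) (mul_nonneg (pow_nonneg h3e 2) hl1))) (mul_nonneg (by norm_num) (mul_nonneg (pow_nonneg h3e 2) hl2))) (mul_nonneg (by norm_num) (mul_nonneg (pow_nonneg h3e 2) hs2))) (mul_nonneg (by norm_num) (mul_nonneg h3e (pow_nonneg hl2 2)))) (mul_nonneg (by norm_num) (pow_nonneg hl1 3))) (mul_nonneg (by norm_num) (mul_nonneg (pow_nonneg hl2 2) hs3))) (mul_nonneg (by norm_num) (mul_nonneg (mul_nonneg (pow_nonneg h3e 2) hl1) hl2))) (mul_nonneg (by norm_num) (mul_nonneg (pow_nonneg h3e 2) (pow_nonneg hl2 2)))) (mul_nonneg (by norm_num) (mul_nonneg h3e (pow_nonneg hl1 3)))) (mul_nonneg (by norm_num) (mul_nonneg (mul_nonneg h3e (pow_nonneg hl2 2)) hs3))) (mul_nonneg (by norm_num) (mul_nonneg (mul_nonneg h3e hl2) (pow_nonneg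 hs3 2)))) (mul_nonneg (by norm_num) (mul_nonneg (pow_nonneg hl1 3) hl2))) (mul_nonneg (by norm_num) (mul_nonneg (pow_nonneg hl1 3) hs3))) (mul_nonneg (by norm_num) (mul_nonneg (mul_nonneg (pow_nonneg hl1 2) hs2) hs3))) (mul_nonneg (by norm_num) (mul_nonneg (mul_nonneg hl1 hs2) (pow_nonneg hs3 2)))) (mul_nonneg (by norm_num) (mul_nonneg (pow_nonneg hl2 3) hs3))) (mul_nonneg (by norm_num) (mul_nonneg (pow_nonneg hl2 2) (pow_nonneg hs3 2)))) (mul_nonneg (by norm_num) (mul_nonneg (pow_nonneg h3e 3) (pow_nonneg hl2 2)))) (mul_nonneg (by norm_num) (mul_nonneg (mul_nonneg (pow_nonneg h3e 2) (pow_nonneg hl1 2)) hs3))) (mul_nonneg (by norm_num) (mul_nonneg (mul_nonneg (mul_nonneg (pow_nonneg h3e 2) hl1) hl2) hs3))) (mul_nonneg (by norm_num) (mul_nonneg (mul_nonneg (mul_nonneg (pow_nonneg h3e 2) hl2) hs2) hs3))) (mul_nonneg (by norm_num) (mul_nonneg (mul_nonneg (pow_nonneg h3e 2) (pow_nonneg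 hs2 2)) hs3))) (mul_nonneg (by norm_num) (mul_nonneg (mul_nonneg h3e (pow_nonneg hl1 3)) hl2))) (mul_nonneg (by norm_num) (mul_nonneg (mul_nonneg h3e (pow_nonneg hl1 3)) hs2))) (mul_nonneg (by norm_num) (mul_nonneg (mul_nonneg h3e (pow_nonneg hl1 2)) (pow_nonneg hs2 2)))) (mul_nonneg (by norm_num) (mul_nonneg (mul_nonneg h3e hl1) (pow_nonneg hs3 3)))) (mul_nonneg (by norm_num) (mul_nonneg h3e (pow_nonneg hl2 4)))) (mul_nonneg (by norm_num) (mul_nonneg (mul_nonneg h3e (pow_nonneg hl2 3)) hs3))) (mul_nonneg (by norm_num) (mul_nonneg (mul_nonneg h3e (pow_nonneg hl2 2)) (pow_nonneg hs3 2)))) (mul_nonneg (by norm_num) (mul_nonneg (mul_nonneg h3e hs2) (pow_nonneg hs3 3)))) (mul_nonneg (by norm_num) (mul_nonneg (pow_nonneg hl1 3) (pow_nonneg hl2 2)))) (mul_nonneg (by norm_num) (mul_nonneg (mul_nonneg (pow_nonneg hl1 2) hs2) (pow_nonneg hs3 2)))) (mul_nonneg (by norm_num) (mul_nonneg (mul_nonneg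 hl1 hs2) (pow_nonneg hs3 3)))) (mul_nonneg (by norm_num) (mul_nonneg (pow_nonneg hl2 3) (pow_nonneg hs3 2)))) (mul_nonneg (by norm_num) (mul_nonneg (pow_nonneg hl2 2) (pow_nonneg hs3 3)))) (mul_nonneg (by norm_num) (mul_nonneg (pow_nonneg h3e 3) (pow_nonneg hl1 3)))) (mul_nonneg (by norm_num) (mul_nonneg (mul_nonneg (pow_nonneg h3e 3) (pow_nonneg hl1 2)) hl2))) (mul_nonneg (by norm_num) (mul_nonneg (mul_nonneg (pow_nonneg h3e 3) hl1) (pow_nonneg hl2 2)))) (mul_nonneg (by norm_num) (mul_nonneg (mul_nonneg (pow_nonneg h3e 3) (pow_nonneg hl2 2)) hs2))) (mul_nonneg (by norm_num) (mul_nonneg (mul_nonneg (mul_nonneg h3e hl1) hl2) (pow_nonneg hs2 3)))) (mul_nonneg (by norm_num) (mul_nonneg (mul_nonneg (mul_nonneg h3e hl1) hl2) (pow_nonneg hs3 3)))) (mul_nonneg (by norm_num) (pow_nonneg hl1 6))) (mul_nonneg (by norm_num) (mul_nonneg (pow_nonneg hl1 4) (pow_nonneg hs3 2)))) (mul_nonneg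 (by norm_num) (mul_nonneg (pow_nonneg hl1 3) (pow_nonneg hl2 3)))) (mul_nonneg (by norm_num) (mul_nonneg (mul_nonneg (pow_nonneg hl1 3) (pow_nonneg hl2 2)) hs3))) (mul_nonneg (by norm_num) (mul_nonneg (mul_nonneg (mul_nonneg (pow_nonneg hl1 2) hl2) hs2) (pow_nonneg hs3 2)))) (mul_nonneg (by norm_num) (mul_nonneg (mul_nonneg (pow_nonneg hl1 2) hs2) (pow_nonneg hs3 3)))) (mul_nonneg (by norm_num) (mul_nonneg (mul_nonneg hl1 hs2) (pow_nonneg hs3 4)))) (mul_nonneg (by norm_num) (pow_nonneg hl2 6))) (mul_nonneg (by norm_num) (mul_nonneg (pow_nonneg hl2 5) hs3))) (mul_nonneg (by norm_num) (mul_nonneg (pow_nonneg hl2 2) (pow_nonneg hs3 4)))) (mul_nonneg (by norm_num) (mul_nonneg hl2 (pow_nonneg hs3 5))))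

/-! ### The route `1 → 3` carries the forest at every gate of the single-low regime -/

/-- the D-certificate in the forest's own variables: `(s−2)(1−q)² ≤ (4−s)·B`, `s = kq(1+p) ∈ [2,3]`,
`B = (k−1)·qp·(1−q) + (k−1)(k−2)·(q(1−p))²/6`. [this work] -/
theorem symTC_bracketD (k : ℕ) (hk : 3 ≤ k) {q p : ℝ} (hq0 : 0 < q) (hq1 : q < 1) (hp0 : 0 < p) (hp1 : p < 1)
    (hs2 : 2 ≤ (k : ℝ) * q * (1 + p)) (hs3 : (k : ℝ) * q * (1 + p) ≤ 3) :
    ((k : ℝ) * q * (1 + p) - 2) * (1 - q) ^ 2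
      ≤ (4 - (k : ℝ) * q * (1 + p)) * (((k : ℝ) - 1) * (q * p) * (1 - q) + ((k : ℝ) - 1) * ((k : ℝ) - 2) * (q * (1 - p)) ^ 2 / 6) := by
  have hk3 : (3 : ℝ) ≤ k := by exact_mod_cast hk
  have hk0 : (0 : ℝ) < k := by linarith
  have h3e : 0 ≤ 1 - 3 * (1 / (k : ℝ)) := by
    rw [mul_one_div, sub_nonneg, div_le_one hk0]; exact hk3
  have h := symTC_certD (1 / (k : ℝ)) ((k : ℝ) * (q * (1 - p))) ((k : ℝ) * (q * p)) (by positivity) h3e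
    (by positivity) (by positivity) (by nlinarith) (by nlinarith)
  have hcoord : 1 - (1 / (k : ℝ)) * ((k : ℝ) * (q * (1 - p)) + (k : ℝ) * (q * p)) = 1 - q := by
    field_simp; ring
  have hsum : (k : ℝ) * (q * (1 - p)) + 2 * ((k : ℝ) * (q * p)) = (k : ℝ) * q * (1 + p) := by ring
  have hbr : (1 - 1 / (k : ℝ)) * ((k : ℝ) * (q * p) * (1 - q) + (1 - 2 * (1 / (k : ℝ))) * ((k : ℝ) * (q * (1 - p))) ^ 2 / 6)
      = ((k : ℝ) - 1) * (q * p) * (1 - q) + ((k : ℝ) - 1) * ((k : ℝ) - 2) * (q * (1 - p)) ^ 2 / 6 := by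
    field_simp
  rw [hcoord, hsum, mul_assoc (4 - (k : ℝ) * q * (1 + p)), hbr] at h
  linarith [h]

/-- the E-certificate in the forest's own variables (floor branch): `(q(1+p)/2)·(1−q)² ≤ (1 − q(1+p)/2)·B`. [this work] -/
theorem symTC_bracketE (k : ℕ) (hk : 3 ≤ k) {q p : ℝ} (hq0 : 0 < q) (hq1 : q < 1) (hp0 : 0 < p) (hp1 : p < 1)
    (hs2 : 2 ≤ (k : ℝ) * q * (1 + p)) (hs3 : (k : ℝ) * q * (1 + p) ≤ 3) :
    (q * (1 + p) / 2) * (1 - q) ^ 2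
      ≤ (1 - q * (1 + p) / 2) * (((k : ℝ) - 1) * (q * p) * (1 - q) + ((k : ℝ) - 1) * ((k : ℝ) - 2) * (q * (1 - p)) ^ 2 / 6) := by
  have hk3 : (3 : ℝ) ≤ k := by exact_mod_cast hk
  have hk0 : (0 : ℝ) < k := by linarith
  have h3e : 0 ≤ 1 - 3 * (1 / (k : ℝ)) := by
    rw [mul_one_div, sub_nonneg, div_le_one hk0]; exact hk3
  have h := symTC_certE (1 / (k : ℝ)) ((k : ℝ) * (q * (1 - p))) ((k : ℝ) * (q * p)) h3e
    (by positivity) (by positivity) (by nlinarith) (by nlinarith)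
  have hcoord : 1 - (1 / (k : ℝ)) * ((k : ℝ) * (q * (1 - p)) + (k : ℝ) * (q * p)) = 1 - q := by
    field_simp; ring
  have hsum : (k : ℝ) * (q * (1 - p)) + 2 * ((k : ℝ) * (q * p)) = (k : ℝ) * q * (1 + p) := by ring
  have hbr : (1 - 1 / (k : ℝ)) * ((k : ℝ) * (q * p) * (1 - q) + (1 - 2 * (1 / (k : ℝ))) * ((k : ℝ) * (q * (1 - p))) ^ 2 / 6)
      = ((k : ℝ) - 1) * (q * p) * (1 - q) + ((k : ℝ) - 1) * ((k : ℝ) - 2) * (q * (1 - p)) ^ 2 / 6 := by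
    field_simp
  have hw : (k : ℝ) * q * (1 + p) * (1 / (k : ℝ)) / 2 = q * (1 + p) / 2 := by
    field_simp
  rw [hcoord, hsum, hw, mul_assoc (1 - q * (1 + p) / 2), hbr] at h
  linarith [h]

/-- from the bracket inequality `γ·Q² ≤ (1−γ)·B` to the rate form `γ/(1−γ)·(c/Q) ≤ c·B/Q³`. [this work] -/
theorem rate_mul_le_of_bracket {γ Q c B : ℝ} (hγ1 : γ < 1) (hQ : 0 < Q) (hc : 0 ≤ c)
    (key : γ * Q ^ 2 ≤ (1 - γ) * B) : γ / (1 - γ) * (c / Q) ≤ c * B / Q ^ 3 := by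
  have h1γ : 0 < 1 - γ := by linarith
  have h := mul_le_mul_of_nonneg_right key (mul_nonneg hc hQ.le)
  rw [div_mul_div_comm, div_le_div_iff₀ (mul_pos h1γ hQ) (pow_pos hQ 3)]
  have e1 : γ * c * Q ^ 3 = γ * Q ^ 2 * (c * Q) := by ring
  have e2 : c * B * ((1 - γ) * Q) = (1 - γ) * B * (c * Q) := by ring
  rw [e1, e2]
  exact h

/-- **CAPACITY OF THE ROUTE `1 → 3` FOR `k ≥ 3` IDENTICAL 2-CHAINS WITH `fmean = kq(1+p) ≤ 3`.**  For every target `2 < T ≤ kq(1+p)` and every floor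
`y` with `2k·y ≤ T` (every top-affordable floor of the gated forest): `freeRate y T 1 3 · f₁ ≤ f₃`.  By the atoms (`Q·f₁ = c`, `Q³·f₃ = c·B`,
`c = k·q(1−p)·Q^k`, `B = (k−1)qpQ + (k−1)(k−2)(q(1−p))²/6`) this is `γ·Q² ≤ (1−γ)·B`, `γ = max(y, (T−2)/2)`: the branch `γ = (T−2)/2` is
`symTC_bracketD` (`T ≤ s`), the branch `γ = y ≤ s/(2k) = q(1+p)/2` is `symTC_bracketE`. [this work] -/
theorem symTC_capacity (k : ℕ) (hk : 3 ≤ k) {q p : ℝ} (hq0 : 0 < q) (hq1 : q < 1) (hp0 : 0 < p) (hp1 : p < 1)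
    (hs3 : (k : ℝ) * q * (1 + p) ≤ 3) {T y : ℝ} (hT2 : 2 < T) (hTs : T ≤ (k : ℝ) * q * (1 + p))
    (hyT : 2 * (k : ℝ) * y ≤ T) (x₁ : ℝ) :
    freeRate y T 1 3 * flaw Lk[k, q, p, x₁] 1 ≤ flaw Lk[k, q, p, x₁] 3 := by
  obtain ⟨_, h1, _, h3⟩ := flaw_replicate_tc_atoms q p x₁ k
  have hk3 : (3 : ℝ) ≤ k := by exact_mod_cast hk
  have hk0 : (0 : ℝ) < k := by linarith
  have hQ0 : 0 < 1 - q := by linarith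
  have hs2 : 2 ≤ (k : ℝ) * q * (1 + p) := by linarith
  obtain ⟨B, hB⟩ : ∃ B : ℝ, B = ((k : ℝ) - 1) * (q * p) * (1 - q) + ((k : ℝ) - 1) * ((k : ℝ) - 2) * (q * (1 - p)) ^ 2 / 6 :=
    ⟨_, rfl⟩
  have hB0 : 0 ≤ B := by
    rw [hB]
    have : 0 ≤ (k : ℝ) - 1 := by linarith
    have : 0 ≤ (k : ℝ) - 2 := by linarith
    positivity
  have hD := symTC_bracketD k hk hq0 hq1 hp0 hp1 hs2 hs3
  have hE := symTC_bracketE k hk hq0 hq1 hp0 hp1 hs2 hs3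
  rw [← hB] at hD hE
  obtain ⟨c, hc⟩ : ∃ c : ℝ, c = (k : ℝ) * (q * (1 - p)) * (1 - q) ^ k := ⟨_, rfl⟩
  have hc0 : 0 ≤ c := by rw [hc]; positivity
  have hf1 : flaw Lk[k, q, p, x₁] 1 = c / (1 - q) := by
    rw [eq_div_iff hQ0.ne', hc]; linarith [h1]
  have hf3 : flaw Lk[k, q, p, x₁] 3 = c * B / (1 - q) ^ 3 := by
    rw [eq_div_iff (pow_pos hQ0 3).ne']
    have e : c * B = (k : ℝ) * ((k : ℝ) - 1) * (q * (1 - p)) * (q * p) * (1 - q) ^ (k + 1)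
        + ((k : ℝ) * ((k : ℝ) - 1) * ((k : ℝ) - 2) / 6) * (q * (1 - p)) ^ 3 * (1 - q) ^ k := by
      rw [hc, hB]; ring
    rw [e, ← h3]; ring
  have hρ : (T - 2 * ((1 : ℕ) : ℝ)) / (((3 : ℕ) : ℝ) - ((1 : ℕ) : ℝ)) = (T - 2) / 2 := by norm_num
  have hy1 : y < 1 := by nlinarith
  have hQ2 : 0 ≤ (1 - q) ^ 2 := sq_nonneg _
  unfold freeRate
  rw [hρ, hf1, hf3]
  rcases le_total y ((T - 2) / 2) with hle | hle
  · rw [max_eq_right hle]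
    refine rate_mul_le_of_bracket (by rw [div_lt_one (by norm_num : (0:ℝ) < 2)]; linarith) hQ0 hc0 ?_
    have a1 : (T - 2) * (1 - q) ^ 2 ≤ ((k : ℝ) * q * (1 + p) - 2) * (1 - q) ^ 2 :=
      mul_le_mul_of_nonneg_right (by linarith) hQ2
    have a2 : (4 - (k : ℝ) * q * (1 + p)) * B ≤ (4 - T) * B := mul_le_mul_of_nonneg_right (by linarith) hB0
    have e1 : (T - 2) / 2 * (1 - q) ^ 2 = ((T - 2) * (1 - q) ^ 2) / 2 := by ring
    have e2 : (1 - (T - 2) / 2) * B = ((4 - T) * B) / 2 := by ring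
    rw [e1, e2]
    exact div_le_div_of_nonneg_right (by linarith) (by norm_num)
  · rw [max_eq_left hle]
    refine rate_mul_le_of_bracket hy1 hQ0 hc0 ?_
    have hyw : y ≤ q * (1 + p) / 2 := by nlinarith
    have a1 : y * (1 - q) ^ 2 ≤ (q * (1 + p) / 2) * (1 - q) ^ 2 := mul_le_mul_of_nonneg_right hyw hQ2
    have a2 : (1 - q * (1 + p) / 2) * B ≤ (1 - y) * B := mul_le_mul_of_nonneg_right (by linarith) hB0
    linarith

/-! ### SDEC of the symmetric forest of 2-chains in the light band `fmean ≤ 3`, every width -/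

/-- **THE SYMMETRIC FOREST OF `k ≥ 3` IDENTICAL 2-CHAINS WITH `k·q·(1+p) ≤ 3` IS SDEC AT EVERY TOP-AFFORDABLE FLOOR — EVERY WIDTH, NO ORACLE.**
For `0 < q < 1`, `0 < p < 1`, `0 < x` with `2x ≤ q(1+p)` and `k·q(1+p) ≤ 3`: `SDEC x (ftop L) (flaw L)` for `L` = `k` copies of the 2-chain
`gate_q(δ₁ ∗ gate_p δ₁)`.  At a gate `a` with `a·kq(1+p) ≤ 2` there is no positive low atom (`decAt_all_of_noPosLow`); otherwise the single positive low
atom `1` is shipped to the atom `3` (cost-safe) and the capacity is `symTC_capacity` (two Handelman certificates in the Poisson coordinates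
`(1/k, kq(1−p), kqp)`), through `decAt_gate_flaw_of_oneLowFan`.  For `k = 3` this is the band `q(1+p) ≤ 1` of arm-1 g54's `sdec_tc3`; the point is
that `k` is a variable. [this work] -/
theorem sdec_symForest_twoChain_light (k : ℕ) (hk : 3 ≤ k) {q p x : ℝ} (hq0 : 0 < q) (hq1 : q < 1) (hp0 : 0 < p) (hp1 : p < 1)
    (hx0 : 0 < x) (hx : 2 * x ≤ q * (1 + p)) (hs3 : (k : ℝ) * q * (1 + p) ≤ 3) (x₁ : ℝ) :
    SDEC x (ftop Lk[k, q, p, x₁]) (flaw Lk[k, q, p, x₁]) := by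
  intro a ha0 ha1 j hj
  have hk3 : (3 : ℝ) ≤ k := by exact_mod_cast hk
  -- law facts of the members and of the forest
  have ρ0 : ∀ h, 0 ≤ (ρ₂[p]) h := by
    intro h; rw [tc_rho_apply]; split_ifs <;> linarith
  have ρM : ∀ h, 2 < h → (ρ₂[p]) h = 0 := by
    intro h hh; rw [tc_rho_apply, if_neg (by omega), if_neg (by omega)]; ring
  have ρ1 : ∑ h ∈ Finset.range (2 + 1), (ρ₂[p]) h = 1 := by
    simp [Finset.sum_range_succ, tc_rho_apply]
  have hOK : ∀ s ∈ Lk[k, q, p, x₁], s.LawOK := by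
    intro s hs
    rw [List.eq_of_mem_replicate hs]
    exact ⟨hq0, hq1, ρ0, ρM, ρ1⟩
  have hmeanρ : Sib.mean TC[q, p, x₁] = 1 + p := by
    simp [Sib.mean, Finset.sum_range_succ, tc_rho_apply]; ring
  have htop : ftop Lk[k, q, p, x₁] = k * 2 := ftop_replicate k TC[q, p, x₁]
  have hfmean : fmean Lk[k, q, p, x₁] = (k : ℝ) * q * (1 + p) := by
    rw [fmean_replicate, hmeanρ]; simp only; ring
  have hqp2 : q * (1 + p) < 2 := by nlinarith
  have hax1 : a * x < 1 := by nlinarith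
  have htaff : x * (ftop Lk[k, q, p, x₁] : ℝ) ≤ fmean Lk[k, q, p, x₁] := by
    rw [htop, hfmean]; push_cast; nlinarith [mul_le_mul_of_nonneg_left hx (Nat.cast_nonneg k)]
  by_cases hT : a * ((k : ℝ) * q * (1 + p)) ≤ 2
  · -- no positive low atom
    obtain ⟨f0, fM, f1, fmn⟩ := flaw_facts Lk[k, q, p, x₁] hOK
    obtain ⟨g0, gM, g1⟩ := gate_laws (ftop Lk[k, q, p, x₁]) (flaw Lk[k, q, p, x₁]) a ha0.le ha1 f0 fM f1
    have gmn : ∑ h ∈ Finset.range (ftop Lk[k, q, p, x₁] + 1), (h : ℝ) * gate (flaw Lk[k, q, p, x₁]) a h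
        = a * ((k : ℝ) * q * (1 + p)) := by rw [sum_mul_gate, fmn, hfmean]
    have hT0 : 0 < a * ((k : ℝ) * q * (1 + p)) := by positivity
    exact decAt_all_of_noPosLow (a * x) (ftop Lk[k, q, p, x₁]) (gate (flaw Lk[k, q, p, x₁]) a) _ (mul_pos ha0 hx0) hax1
      g0 gM g1 gmn hT0 hT (by rw [← hfmean]; nlinarith [mul_le_mul_of_nonneg_left htaff ha0.le]) j hj
  · rw [not_le] at hT
    have hT2 : 2 < a * fmean Lk[k, q, p, x₁] := by rw [hfmean]; exact hT
    have hT4 : a * fmean Lk[k, q, p, x₁] ≤ 4 := by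
      rw [hfmean]; nlinarith [mul_le_mul_of_nonneg_left hs3 ha0.le]
    refine decAt_gate_flaw_of_oneLowFan hx0 ha0 ha1 hax1 Lk[k, q, p, x₁] hOK htaff hT2 hT4 {3} ?_ ?_ j hj
    · intro h hh
      rw [Finset.mem_singleton] at hh
      subst hh
      refine ⟨by norm_num, by rw [htop]; omega, by rw [hfmean]; push_cast; nlinarith [mul_le_mul_of_nonneg_left hs3 ha0.le], ?_⟩
      -- cost-safety `2·(a x) ≤ a·fmean − 1`: `a x ≤ a·q(1+p)/2 = a·fmean/(2k) ≤ a·fmean/6` and `a·fmean > 2`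
      rw [hfmean]; push_cast
      have h1 : a * x * 2 ≤ a * (q * (1 + p)) := by nlinarith [mul_le_mul_of_nonneg_left hx ha0.le]
      have h2 : 3 * (a * (q * (1 + p))) ≤ a * ((k : ℝ) * q * (1 + p)) := by
        have : 0 ≤ a * (q * (1 + p)) := by positivity
        nlinarith
      nlinarith
    · rw [Finset.sum_singleton, hfmean, le_div_iff₀ (freeRate_pos _ _ 1 3 (mul_pos ha0 hx0) hax1
        (by push_cast; linarith) (by norm_num) (by push_cast; nlinarith [mul_le_mul_of_nonneg_left hs3 ha0.le])), mul_comm]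
      refine symTC_capacity k hk hq0 hq1 hp0 hp1 hs3 hT (by nlinarith [mul_le_mul_of_nonneg_left hs3 ha0.le]) ?_ x₁
      nlinarith [mul_le_mul_of_nonneg_left hx ha0.le, mul_le_mul_of_nonneg_left hx (mul_nonneg ha0.le (Nat.cast_nonneg k))]

/-- **THE TREE-BUILT FORM.**  `k ≥ 3` identical 2-chain siblings `t = gate_q(δ₁ ∗ gate_p δ₁)` with `t.TreeOK x` (root gate `q`, sub-forest floor `x₁`, floor
`x ≤ q·x₁`) and `k·q·(1+p) ≤ 3` form an SDEC forest at `x` — every width, every such `q`, `p`, no oracle (the list form of `SiblingStep` on this family;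
the tree-OK floor gives `2x ≤ q(1+p)` by top-affordability of the tree-built sub-forest). [this work] -/
theorem sdec_symForest_twoChain_light_treeOK (k : ℕ) (hk : 3 ≤ k) {q p x₁ x : ℝ} (hx0 : 0 < x) (hp0 : 0 < p) (hp1 : p < 1)
    (ht : Sib.TreeOK x TC[q, p, x₁]) (hs3 : (k : ℝ) * q * (1 + p) ≤ 3) :
    SDEC x (ftop Lk[k, q, p, x₁]) (flaw Lk[k, q, p, x₁]) := by
  obtain ⟨hq0, hq1, hxq, hT, _⟩ := ht
  obtain ⟨_, _, _, _, _, hta⟩ := hT.lawFacts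
  have hmean : ∑ h ∈ Finset.range (2 + 1), (h : ℝ) * (ρ₂[p]) h = 1 + p := by
    simp [Finset.sum_range_succ, tc_rho_apply]; ring
  have hta' : x₁ * 2 ≤ 1 + p := by
    change x₁ * ((2 : ℕ) : ℝ) ≤ ∑ h ∈ Finset.range (2 + 1), (h : ℝ) * (ρ₂[p]) h at hta
    rw [hmean] at hta
    exact_mod_cast hta
  exact sdec_symForest_twoChain_light k hk hq0 hq1 hp0 hp1 hx0 (by nlinarith) hs3 x₁

end LawDec
end Quant
end Summit.CriticalPhenomena.PercolationContinuityZ3.Theorems
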